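import Literature.NumberTheory.EllipticCurves.KodairaNeronUnramifiedProofs
import Literature.NumberTheory.EllipticCurves.KodairaNeronAdditiveProofs
import HarnessLib

/-!
# Crux `FreyModularity` (stmt-ABC-11340), line `Sketch`, stub `stub_nineTransfer`:
# Kodaira–Néron at an additive place as an exponent `c ∈ {1, 2, 3, 4}` over `K_v^nr`

First support file for the stub `stub_nineTransfer` (Silverberg, CSS 1997, Prop. 7.1: for
elliptic curves `E, E'/ℚ` with `E[5] ≅ E'[5]` and `9 ∤ N_E`, also `9 ∤ N_{E'}`).  The arithmetic
content of that transfer is the classical fact that **at a place of additive reduction the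
inertia group fixes no point of order `ℓ ≥ 5`** (`ℓ ≠ p`): an `I_v`-fixed `ℓ`-torsion point lies in
`E(K_v^nr)`, and `E(K_v^nr)[ℓ] ↪ E(K_v^nr)/E₀(K_v^nr)`, a group of order `c_v ∈ {1, 2, 3, 4}`
(Kodaira–Néron, Silverman *ATAEC* Cor. IV.9.2(d); `E₀(K_v^nr)` has no `ℓ`-torsion since
`E₀/E₁ ≅ k̄⁺` and `E₁` is `ℓ`-torsion-free, *AEC* VII.3.1, VII.5.1(c)).  The tree proves the
finiteness of `E(K_v^nr)/E₀(K_v^nr)` at the additive places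
(`WeierstrassCurve.kodairaNeron_exists_finset_reducesToNonsingular_of_hasAdditiveReductionAt`,
`KodairaNeronAdditiveProofs`; `IsDedekindDomain.HeightOneSpectrum.index_nonsingularReductionSubgroup_map_ne_zero_of_isAdditive`,
`KodairaNeronUnramifiedProofs`) but exports only `index ≠ 0`; its proof computes the index type by
type (`II`: `1`, `III`: `2`, `IV`: `1` or `3`, `I₀*`: `1, 2, 4`, `Iₙ*`: `2, 4`, `IV*`: `1, 3`,
`III*`: `2`, `II*`: `1`).  This file re-runs that proof verbatim keeping the bound `≤ 4`:

* `index_nonsingularReductionSubgroup_map_le_four_of_isAdditive` — for an integral equation `X₀`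
  over `𝓞_v` whose Tate symbol is additive, `1 ≤ [J(K_v^nr) : E₀] ≤ 4` for `J = X₀ ⊗ 𝒪ⁿʳ`
  (word for word the tree's `…_ne_zero_of_isAdditive`, with the conclusion strengthened);
* `stub_nineTransfer_exponent` — **Kodaira–Néron as an exponent `c ≤ 4`**: for an elliptic curve
  `E/K` over a number field with additive reduction at `v`, there is `c ∈ {1, …, 4}` such that
  `c • P ∈ E₀` (nonsingular reduction for the spectral valuation `|·|_v`) for every point `P` of
  the minimal model over `K̄_v` fixed by the inertia group `I_𝔐` (Steps (2)–(4) of the tree's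
  `kodairaNeron_exists_finset_reducesToNonsingular_of_hasAdditiveReductionAt`, verbatim, with the
  representatives replaced by `c = [J(K_v^nr) : E₀]`).

## References

* [SilvermanATAEC1994] J. H. Silverman, *Advanced Topics in the Arithmetic of Elliptic Curves*,
  GTM 151 (1994), Cor. IV.9.2(d) (PDF p. 340), Algorithm 9.4 and Table 4.1 (pp. 341–350).
* [SilvermanAEC2009] J. H. Silverman, *The Arithmetic of Elliptic Curves*, 2nd ed. (2009),
  Cor. VII.6.2 and the proof of Thm. VII.7.1 (PDF pp. 177–179).
* [SilverbergCSS1997] A. Silverberg, *Explicit families of elliptic curves with prescribed mod N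
  representations*, in: Cornell–Silverman–Stevens (eds.), *Modular Forms and Fermat's Last
  Theorem* (1997), Prop. 7.1.

## Design

Theorems only; `open scoped Classical NNReal`; `K : Type`; the spectral valuation is quantified
with `hw` and `K_v`, `K̄_v`, `K_v^nr`, `𝒪ⁿʳ`, `𝓞_v` are spelled out as expressions, exactly as in
`KodairaNeronAdditiveProofs` / `KodairaNeronUnramifiedProofs`, whose proofs are followed verbatim;
`set_option maxHeartbeats` is raised for the two transfer theorems as there.
-/

-- `Summit.<Summit>.<Problem>` is the mandated summit-side namespace (CONVENTIONS §2); for the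
-- single-conjunct summit `ABC` the two coincide, so the duplicate `ABC.ABC` is deliberate.
set_option linter.dupNamespace false

noncomputable section

open scoped Classical NNReal NumberField
open NumberField IsDedekindDomain Field Polynomial IsLocalRing

namespace Summit.ABC.ABC.Theorems

open Literature.NumberTheory.EllipticCurves Literature.NumberTheory.EllipticCurves.LocalIndex
  Literature.NumberTheory.GaloisRepresentations
  Literature.NumberTheory.GaloisRepresentations.IsNonarchimedeanLocalField
  Literature.NumberTheory.DiophantineGeometry Literature.NumberTheory.DiophantineGeometry.TateAlgorithm
  Literature.NumberTheory.DiophantineGeometry.KodairaSymbol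
  IsDedekindDomain.HeightOneSpectrum

variable {K : Type} [Field K] [NumberField K] {v : HeightOneSpectrum (𝓞 K)}
  {w : Valuation (AlgebraicClosure (v.adicCompletion K)) ℝ≥0}
  (hw : ∀ x, (w x : ℝ) = spectralNorm (v.adicCompletion K) (AlgebraicClosure (v.adicCompletion K)) x)

/-! ## The local index over `𝒪ⁿʳ` at an additive type is `1, 2, 3` or `4` -/

set_option maxHeartbeats 4000000 in
include hw in
/-- **`1 ≤ [J(K_v^nr) : E₀] ≤ 4` for `J = X₀ ⊗ 𝒪ⁿʳ` when Tate's algorithm returns an additive type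
on `X₀`** — the tree's `index_nonsingularReductionSubgroup_map_ne_zero_of_isAdditive`
(`KodairaNeronUnramifiedProofs`) with its conclusion strengthened to the bound its proof computes:
the normal form `D • X₀` of the type over `𝓞_v` keeps its defining `π`-adic conditions in `𝒪ⁿʳ`
(`map_mem_maximalIdeal_pow_iff`, `distinctRootCount_cubicStep6_map_eq_three`,
`distinctRootCount_quadraticStep8_map_eq_two`), so the elementary index computations
`index_*_of_normalForm_*` of `NeronComponentIndexType*Proofs` over the henselian discrete valuation
ring `𝒪ⁿʳ` give `[J(K_v^nr) : E₀] ∈ {1, 2, 3, 4}` (types `II`, `II*`: every point has nonsingular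
reduction).  Silverman, *ATAEC*, Cor. IV.9.2(d): "otherwise, `E(K)/E₀(K)` has order 1, 2, 3, or 4".
[cite: SilvermanATAEC1994, Cor. IV.9.2(d) with IV.9.4 and Table 4.1 (PDF pp. 340–346)] -/
theorem index_nonsingularReductionSubgroup_map_le_four_of_isAdditive
    [IsDiscreteValuationRing (Valuation.valuationSubring (Valuation.comap (algebraMap (maxUnramified (v.adicCompletion K)) (AlgebraicClosure (v.adicCompletion K))) w))] [HenselianLocalRing (Valuation.valuationSubring (Valuation.comap (algebraMap (maxUnramified (v.adicCompletion K)) (AlgebraicClosure (v.adicCompletion K))) w))]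
    {φ : (v.adicCompletionIntegers K) →+* (Valuation.valuationSubring (Valuation.comap (algebraMap (maxUnramified (v.adicCompletion K)) (AlgebraicClosure (v.adicCompletion K))) w))} (hφ : ∀ a, (((φ a : (Valuation.valuationSubring (Valuation.comap (algebraMap (maxUnramified (v.adicCompletion K)) (AlgebraicClosure (v.adicCompletion K))) w))) : (maxUnramified (v.adicCompletion K))) : (AlgebraicClosure (v.adicCompletion K))) = algebraMap (v.adicCompletion K) (AlgebraicClosure (v.adicCompletion K)) (a : (v.adicCompletion K)))
    (X₀ : WeierstrassCurve (v.adicCompletionIntegers K)) (hΔ : X₀.Δ ≠ 0) (hs : X₀.kodairaSymbolOfMinimal.IsAdditive) :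
    letI : DecidableEq (maxUnramified (v.adicCompletion K)) := fun a b ↦ Classical.propDecidable (a = b)
    ((X₀.map φ).nonsingularReductionSubgroup (integers_valuationRing_valuation (Valuation.valuationSubring (Valuation.comap (algebraMap (maxUnramified (v.adicCompletion K)) (AlgebraicClosure (v.adicCompletion K))) w)) (maxUnramified (v.adicCompletion K)))).index ≠ 0 ∧
      ((X₀.map φ).nonsingularReductionSubgroup (integers_valuationRing_valuation (Valuation.valuationSubring (Valuation.comap (algebraMap (maxUnramified (v.adicCompletion K)) (AlgebraicClosure (v.adicCompletion K))) w)) (maxUnramified (v.adicCompletion K)))).index ≤ 4 := by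
  letI instDec : DecidableEq (maxUnramified (v.adicCompletion K)) := fun a b ↦ Classical.propDecidable (a = b)
  haveI : PerfectField (ResidueField (v.adicCompletionIntegers K)) := PerfectField.ofFinite
  have hvR := integers_valuationRing_valuation (Valuation.valuationSubring (Valuation.comap (algebraMap (maxUnramified (v.adicCompletion K)) (AlgebraicClosure (v.adicCompletion K))) w)) (maxUnramified (v.adicCompletion K))
  have hinjR := IsFractionRing.injective (Valuation.valuationSubring (Valuation.comap (algebraMap (maxUnramified (v.adicCompletion K)) (AlgebraicClosure (v.adicCompletion K))) w)) (maxUnramified (v.adicCompletion K))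
  show ((X₀.map φ).nonsingularReductionSubgroup hvR).index ≠ 0 ∧
    ((X₀.map φ).nonsingularReductionSubgroup hvR).index ≤ 4
  -- transfer of the `π`-adic conditions
  have T : ∀ (a : (v.adicCompletionIntegers K)) (k : ℕ), a ∈ maximalIdeal (v.adicCompletionIntegers K) ^ k → φ a ∈ maximalIdeal (Valuation.valuationSubring (Valuation.comap (algebraMap (maxUnramified (v.adicCompletion K)) (AlgebraicClosure (v.adicCompletion K))) w)) ^ k :=
    fun a k h ↦ (map_mem_maximalIdeal_pow_iff hw hφ a k).mpr h
  have T1 : ∀ a : (v.adicCompletionIntegers K), a ∈ maximalIdeal (v.adicCompletionIntegers K) → φ a ∈ maximalIdeal (Valuation.valuationSubring (Valuation.comap (algebraMap (maxUnramified (v.adicCompletion K)) (AlgebraicClosure (v.adicCompletion K))) w)) :=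
    fun a h ↦ (map_mem_maximalIdeal_iff hw hφ a).mpr h
  have N : ∀ (a : (v.adicCompletionIntegers K)) (k : ℕ), a ∉ maximalIdeal (v.adicCompletionIntegers K) ^ k → φ a ∉ maximalIdeal (Valuation.valuationSubring (Valuation.comap (algebraMap (maxUnramified (v.adicCompletion K)) (AlgebraicClosure (v.adicCompletion K))) w)) ^ k :=
    fun a k h h' ↦ h ((map_mem_maximalIdeal_pow_iff hw hφ a k).mp h')
  have hΔφ : ∀ D : WeierstrassCurve.VariableChange (v.adicCompletionIntegers K), ((D • X₀).map φ).Δ ≠ 0 := fun D h0 ↦ by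
    rw [WeierstrassCurve.map_Δ, WeierstrassCurve.variableChange_Δ, map_mul,
      mul_eq_zero] at h0
    rcases h0 with h0 | h0
    · exact (((D.u⁻¹ ^ 12).isUnit.map φ).ne_zero) (by simpa using h0)
    · exact hΔ (injective_of_coe_eq_algebraMap hφ (by rw [h0, map_zero]))
  have hidx : ∀ D : WeierstrassCurve.VariableChange (v.adicCompletionIntegers K),
      (((D • X₀).map φ).nonsingularReductionSubgroup hvR).index =
      ((X₀.map φ).nonsingularReductionSubgroup hvR).index := fun D ↦ by
    rw [← WeierstrassCurve.map_variableChange]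
    exact index_nonsingularReductionSubgroup_smul (X₀.map φ) (D.map φ)
  have hall : ∀ J : WeierstrassCurve (Valuation.valuationSubring (Valuation.comap (algebraMap (maxUnramified (v.adicCompletion K)) (AlgebraicClosure (v.adicCompletion K))) w)),
      (∀ a b : (Valuation.valuationSubring (Valuation.comap (algebraMap (maxUnramified (v.adicCompletion K)) (AlgebraicClosure (v.adicCompletion K))) w)), J.toAffine.Equation a b →
        ¬ (J.map (residue (Valuation.valuationSubring (Valuation.comap (algebraMap (maxUnramified (v.adicCompletion K)) (AlgebraicClosure (v.adicCompletion K))) w)))).toAffine.Nonsingular (residue (Valuation.valuationSubring (Valuation.comap (algebraMap (maxUnramified (v.adicCompletion K)) (AlgebraicClosure (v.adicCompletion K))) w)) a) (residue (Valuation.valuationSubring (Valuation.comap (algebraMap (maxUnramified (v.adicCompletion K)) (AlgebraicClosure (v.adicCompletion K))) w)) b) → False) →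
      (J.nonsingularReductionSubgroup hvR).index = 1 := by
    intro J hJ
    rw [AddSubgroup.index_eq_one, eq_top_iff]
    intro P _
    rw [WeierstrassCurve.mem_nonsingularReductionSubgroup_iff]
    rcases point_cases hvR P with rfl | ⟨x, y, h, rfl, hx⟩ | ⟨a, b, h, rfl⟩
    · trivial
    · exact Or.inl ((not_mem_range_iff hvR).mpr hx)
    · refine (WeierstrassCurve.hasNonsingularReduction_some_algebraMap_iff hinjR h).mpr ?_
      have he : J.toAffine.Equation a b :=
        (WeierstrassCurve.Affine.map_equation _ hinjR a b).mp h.left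
      by_contra hns
      exact hJ a b he hns
  generalize hs' : X₀.kodairaSymbolOfMinimal = s at hs
  cases s with
  | I n =>
    exfalso
    rcases Nat.eq_zero_or_pos n with rfl | hn
    · exact hs.1 rfl
    · exact hs.2 ⟨n, hn.ne', rfl⟩
  | II =>
    obtain ⟨hΔm, -, ha₆⟩ := kodairaSymbolOfMinimal_eq_II_imp X₀ hs'
    have hex := exists_variableChange_step2_of_perfectField X₀ hΔm
    rw [show normalizeStep2 X₀ = hex.choose • X₀ from dif_pos hex] at ha₆
    obtain ⟨-, h3, h4, h6⟩ := hex.choose_spec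
    have key := hall ((hex.choose • X₀).map φ) fun a b he hns ↦ by
      obtain ⟨ha, hb⟩ := mem_maximalIdeal_of_not_nonsingular (T1 _ h3) (T1 _ h4) (T1 _ h6) he hns
      exact N _ 2 ha₆ (a₆_mem_sq_of_equation (T1 _ h3) (T1 _ h4) he ha hb)
    rw [hidx] at key
    omega
  | III =>
    obtain ⟨D, h1, h2, h3, h4, h4', h6⟩ := exists_smul_of_kodairaSymbolOfMinimal_eq_III X₀ hs'
    have key := index_eq_two_of_normalForm_III (K := (maxUnramified (v.adicCompletion K))) ((D • X₀).map φ) (hΔφ D) (T1 _ h1)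
      (T1 _ h2) (T1 _ h3) (T1 _ h4) (N _ 2 h4') (T _ 2 h6)
    rw [hidx] at key
    omega
  | IV =>
    obtain ⟨D, h1, h2, h3, h4, h6, hb₆⟩ := exists_smul_of_kodairaSymbolOfMinimal_eq_IV X₀ hs'
    have hb₆' : ((D • X₀).map φ).b₆ ∉ maximalIdeal (Valuation.valuationSubring (Valuation.comap (algebraMap (maxUnramified (v.adicCompletion K)) (AlgebraicClosure (v.adicCompletion K))) w)) ^ 3 := by
      rw [WeierstrassCurve.map_b₆]; exact N _ 3 hb₆
    have key := index_mem_of_normalForm_IV (K := (maxUnramified (v.adicCompletion K))) ((D • X₀).map φ) (T1 _ h1) (T1 _ h2)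
      (T1 _ h3) (T _ 2 h4) (T _ 2 h6) hb₆'
    rw [hidx] at key
    omega
  | Istar n =>
    cases n with
    | zero =>
      obtain ⟨D, h1, h2, h3, h4, h6, hP3⟩ :=
        exists_smul_of_kodairaSymbolOfMinimal_eq_Istar_zero X₀ hΔ hs'
      have hP3' := distinctRootCount_cubicStep6_map_eq_three hw hφ (D • X₀) h2 h4 h6 hP3
      have key := index_mem_of_normalForm_Istar_zero (K := (maxUnramified (v.adicCompletion K))) ((D • X₀).map φ) (T1 _ h1)
        (T1 _ h2) (T _ 2 h3) (T _ 2 h4) (T _ 3 h6) hP3'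
      rw [hidx] at key
      omega
    | succ n =>
      obtain ⟨D, h1, h2, h2', h3, h4, h6⟩ :=
        exists_smul_of_kodairaSymbolOfMinimal_eq_Istar_succ X₀ hs'
      have key := index_mem_of_normalForm_Istar_succ (K := (maxUnramified (v.adicCompletion K))) ((D • X₀).map φ) (hΔφ D)
        (T1 _ h1) (T1 _ h2) (N _ 2 h2') (T _ 2 h3) (T _ 3 h4) (T _ 4 h6)
      rw [hidx] at key
      omega
  | IVstar =>
    obtain ⟨D, h1, h2, h3, h4, h6, h8⟩ := exists_smul_of_kodairaSymbolOfMinimal_eq_IVstar X₀ hs'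
    have h8' := distinctRootCount_quadraticStep8_map_eq_two hw hφ (D • X₀) h3 h6 h8
    have key := index_mem_of_normalForm_IVstar (K := (maxUnramified (v.adicCompletion K))) ((D • X₀).map φ) (T1 _ h1) (T _ 2 h2)
      (T _ 2 h3) (T _ 3 h4) (T _ 4 h6) h8'
    rw [hidx] at key
    omega
  | IIIstar =>
    obtain ⟨D, h1, h2, h3, h4, h4', h6⟩ :=
      exists_smul_of_kodairaSymbolOfMinimal_eq_IIIstar X₀ hs'
    have key := index_eq_two_of_normalForm_IIIstar (K := (maxUnramified (v.adicCompletion K))) ((D • X₀).map φ) (hΔφ D) (T1 _ h1)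
      (T _ 2 h2) (T _ 3 h3) (T _ 3 h4) (N _ 4 h4') (T _ 5 h6)
    rw [hidx] at key
    omega
  | IIstar =>
    obtain ⟨D, h1, h2, h3, h4, h6, h6'⟩ := exists_smul_of_kodairaSymbolOfMinimal_eq_IIstar X₀ hs'
    have key := hall ((D • X₀).map φ) fun a b he hns ↦ by
      obtain ⟨ha, hb⟩ := mem_maximalIdeal_of_not_nonsingular
        (Ideal.pow_le_self three_ne_zero (T _ 3 h3))
        (Ideal.pow_le_self four_ne_zero (T _ 4 h4)) (Ideal.pow_le_self (by norm_num) (T _ 5 h6))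
        he hns
      apply N _ 6 h6'
      have hd := dvd_a₆_of_equation_IIstar (irreducible_uniformizer (R := (Valuation.valuationSubring (Valuation.comap (algebraMap (maxUnramified (v.adicCompletion K)) (AlgebraicClosure (v.adicCompletion K))) w))))
        (mem_maximalIdeal_iff_dvd.mp (T1 _ h1)) (mem_maximalIdeal_pow_iff_dvd.mp (T _ 2 h2))
        (mem_maximalIdeal_pow_iff_dvd.mp (T _ 3 h3)) (mem_maximalIdeal_pow_iff_dvd.mp (T _ 4 h4))
        (mem_maximalIdeal_pow_iff_dvd.mp (T _ 5 h6)) he (mem_maximalIdeal_iff_dvd.mp ha)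
        (mem_maximalIdeal_iff_dvd.mp hb)
      exact mem_maximalIdeal_pow_iff_dvd.mpr hd
    rw [hidx] at key
    omega

/-! ## Kodaira–Néron as an exponent `c ≤ 4` on the inertia invariants -/

set_option maxHeartbeats 4000000 in
/-- **Registered helper stub toward `stub_nineTransfer`: Kodaira–Néron at an additive place as an
exponent `c ∈ {1, 2, 3, 4}`.**  Let `E/K` be an elliptic curve over a number field with additive
reduction at the finite place `v`, `X` its minimal model at `v`, `w = |·|_v` the spectral
valuation of `K̄_v` and `𝔐` the prime of `\bar 𝓞_v` above `𝓂_v` with inertia group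
`I_𝔐 ≤ Γ_{K_v}` (so that the `I_𝔐`-fixed points of `X(K̄_v)` are `E(K_v^nr)`).  Then there is
`c ∈ {1, 2, 3, 4}` with `c • P ∈ E₀` (`Literature.NumberTheory.EllipticCurves.ReducesToNonsingular`
for `|·|_v`) for every `I_𝔐`-fixed `P ∈ X(K̄_v)`: namely `c = [J(K_v^nr) : E₀]`, `J = X₀ ⊗ 𝒪ⁿʳ`
(`index_nonsingularReductionSubgroup_map_le_four_of_isAdditive`), since an `I_𝔐`-fixed point has
coordinates in `K_v^nr = (K̄_v)^{I_𝔐}` (`mem_maxUnramified_iff_forall_inertia`), `c` times a point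
of `J(K_v^nr)` lies in `E₀` (`AddSubgroup.nsmul_index_mem`), and `E₀` over `𝒪ⁿʳ` maps into `E₀`
over `𝒪_w` (Steps (2)–(4) of the tree's
`kodairaNeron_exists_finset_reducesToNonsingular_of_hasAdditiveReductionAt`, verbatim).
Silverman, *ATAEC*, Cor. IV.9.2(d) over `K_v^nr` (as in *AEC*, proof of Thm. VII.7.1).
[cite: SilvermanATAEC1994, Cor. IV.9.2(d) (PDF p. 340)] -/
theorem stub_nineTransfer_exponent :
    ∀ {K : Type} [Field K] [NumberField K] (W : WeierstrassCurve K) [W.IsElliptic]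
      {v : HeightOneSpectrum (𝓞 K)}, W.HasAdditiveReductionAt v →
      ∀ {w : Valuation (AlgebraicClosure (v.adicCompletion K)) ℝ≥0},
      (∀ x, (w x : ℝ) = spectralNorm (v.adicCompletion K) (AlgebraicClosure (v.adicCompletion K)) x) →
      ∀ {𝔐 : Ideal v.localAbsIntegers}, 𝔐 ∈ v.localPrimesAbove →
      ∃ c : ℕ, c ≠ 0 ∧ c ≤ 4 ∧
        ∀ P : ((W.localMinimalModel v).baseChange (AlgebraicClosure (v.adicCompletion K))).toAffine.Point,
          (∀ σ ∈ 𝔐.inertia (absoluteGaloisGroup (v.adicCompletion K)),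
            WeierstrassCurve.Affine.Point.map ((absoluteGaloisGroup.toAlgEquiv _ σ : (AlgebraicClosure (v.adicCompletion K)) ≃ₐ[(v.adicCompletion K)] (AlgebraicClosure (v.adicCompletion K))) : (AlgebraicClosure (v.adicCompletion K)) →ₐ[(v.adicCompletion K)] (AlgebraicClosure (v.adicCompletion K))) P = P) →
          ReducesToNonsingular w (residue w.integer) (c • P) := by
  intro K _ _ W _ v hadd w hw 𝔐 h𝔐
  -- the classical decidable equality on `K_v^nr`, as in the index theorems of the tree
  letI instDec : DecidableEq (maxUnramified (v.adicCompletion K)) := fun a b => Classical.propDecidable (a = b)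
  haveI := isDiscreteValuationRing_unrIntegers hw
  haveI := henselianLocalRing_unrIntegers hw
  haveI : PerfectField (ResidueField (v.adicCompletionIntegers K)) := PerfectField.ofFinite
  obtain ⟨φ, hφ⟩ := exists_ringHom_adicCompletionIntegers_unrIntegers hw
  obtain ⟨ψ, hψ⟩ := exists_ringHom_unrIntegers_integer (w := w)
  have hvR := integers_valuationRing_valuation (Valuation.valuationSubring (Valuation.comap (algebraMap (maxUnramified (v.adicCompletion K)) (AlgebraicClosure (v.adicCompletion K))) w)) (maxUnramified (v.adicCompletion K))
  have hinjR := IsFractionRing.injective (Valuation.valuationSubring (Valuation.comap (algebraMap (maxUnramified (v.adicCompletion K)) (AlgebraicClosure (v.adicCompletion K))) w)) (maxUnramified (v.adicCompletion K))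
  haveI hXell : (W.localMinimalModel v).IsElliptic := W.isElliptic_localMinimalModel v
  have hX₀K : (W.localMinimalIntegralModel v).baseChange (v.adicCompletion K) = W.localMinimalModel v :=
    WeierstrassCurve.baseChange_integralModel_eq (v.adicCompletionIntegers K) (W.localMinimalModel v)
  have hΔ : (W.localMinimalIntegralModel v).Δ ≠ 0 := fun h0 ↦ by
    have : (W.localMinimalModel v).Δ = 0 := by
      rw [← hX₀K]
      change ((W.localMinimalIntegralModel v).map (algebraMap _ _)).Δ = 0
      rw [WeierstrassCurve.map_Δ, h0, map_zero]
    exact hXell.isUnit.ne_zero this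
  have hsym : (W.localMinimalIntegralModel v).kodairaSymbolOfMinimal.IsAdditive := by
    have h := (WeierstrassCurve.isAdditive_kodairaSymbolAt_iff_holds v W).mpr hadd
    rwa [WeierstrassCurve.kodairaSymbolAt_def] at h
  /- (1) the index of `E₀` in `J(K_v^nr)`, `J = X₀ ⊗ 𝒪ⁿʳ`, is `1, 2, 3` or `4` -/
  obtain ⟨hidx0, hidx4⟩ :=
    index_nonsingularReductionSubgroup_map_le_four_of_isAdditive hw hφ (W.localMinimalIntegralModel v) hΔ hsym
  /- the model `J = X₀ ⊗ 𝒪ⁿʳ`, its base changes to `K_v^nr` and to `𝒪_w`, `K̄_v` -/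
  have hJ : ((W.localMinimalIntegralModel v).map φ).baseChange (maxUnramified (v.adicCompletion K)) =
      (W.localMinimalModel v).baseChange (maxUnramified (v.adicCompletion K)) := by
    rw [← hX₀K]
    change ((W.localMinimalIntegralModel v).map φ).map (algebraMap _ _) =
      ((W.localMinimalIntegralModel v).map (algebraMap (v.adicCompletionIntegers K) (v.adicCompletion K))).map (algebraMap (v.adicCompletion K) (maxUnramified (v.adicCompletion K)))
    rw [WeierstrassCurve.map_map, WeierstrassCurve.map_map]
    congr 1
    refine RingHom.ext fun a ↦ Subtype.ext ?_
    change (((φ a : (Valuation.valuationSubring (Valuation.comap (algebraMap (maxUnramified (v.adicCompletion K)) (AlgebraicClosure (v.adicCompletion K))) w))) : (maxUnramified (v.adicCompletion K))) : (AlgebraicClosure (v.adicCompletion K))) = ((algebraMap (v.adicCompletion K) (maxUnramified (v.adicCompletion K)) (algebraMap (v.adicCompletionIntegers K) (v.adicCompletion K) a) : (maxUnramified (v.adicCompletion K))) : (AlgebraicClosure (v.adicCompletion K)))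
    rw [hφ, IntermediateField.coe_algebraMap_apply]
    rfl
  have hW₀ : (((W.localMinimalIntegralModel v).map φ).map ψ).baseChange (AlgebraicClosure (v.adicCompletion K)) =
      (W.localMinimalModel v).baseChange (AlgebraicClosure (v.adicCompletion K)) := by
    rw [← hX₀K]
    change (((W.localMinimalIntegralModel v).map φ).map ψ).map (algebraMap _ _) =
      ((W.localMinimalIntegralModel v).map (algebraMap (v.adicCompletionIntegers K) (v.adicCompletion K))).map (algebraMap (v.adicCompletion K) (AlgebraicClosure (v.adicCompletion K)))
    rw [WeierstrassCurve.map_map, WeierstrassCurve.map_map, WeierstrassCurve.map_map]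
    congr 1
    refine RingHom.ext fun a ↦ ?_
    change ((ψ (φ a) : w.integer) : (AlgebraicClosure (v.adicCompletion K))) = algebraMap (v.adicCompletion K) (AlgebraicClosure (v.adicCompletion K)) (algebraMap (v.adicCompletionIntegers K) (v.adicCompletion K) a)
    rw [hψ, hφ]
    rfl
  -- the residue field of `𝒪ⁿʳ` embeds into that of `𝒪_w`
  haveI hψloc : IsLocalHom ψ := ⟨fun a ha ↦ by
    by_contra hna
    have hmem : a ∈ maximalIdeal (Valuation.valuationSubring (Valuation.comap (algebraMap (maxUnramified (v.adicCompletion K)) (AlgebraicClosure (v.adicCompletion K))) w)) := (IsLocalRing.mem_maximalIdeal _).mpr (mem_nonunits_iff.mpr hna)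
    have := (map_mem_maximalIdeal_integer_iff hψ a).mpr hmem
    exact (mem_nonunits_iff.mp ((IsLocalRing.mem_maximalIdeal _).mp this)) ha⟩
  have hκ : (((W.localMinimalIntegralModel v).map φ).map ψ).map (residue w.integer) =
      ((((W.localMinimalIntegralModel v).map φ).map (residue (Valuation.valuationSubring (Valuation.comap (algebraMap (maxUnramified (v.adicCompletion K)) (AlgebraicClosure (v.adicCompletion K))) w)))).map
        (IsLocalRing.ResidueField.map ψ)) := by
    simp only [WeierstrassCurve.map_map]
    congr 1
  /- the maps on points: `J(K_v^nr) ≃ X(K_v^nr) → X(K̄_v)` -/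
  set e₁ := WeierstrassCurve.Affine.Point.congrEquiv hJ with he₁
  set ι : ((W.localMinimalModel v).baseChange (maxUnramified (v.adicCompletion K))).toAffine.Point →+
      ((W.localMinimalModel v).baseChange (AlgebraicClosure (v.adicCompletion K))).toAffine.Point :=
    WeierstrassCurve.Affine.Point.map (W' := W.localMinimalModel v) (IsScalarTower.toAlgHom (v.adicCompletion K) (maxUnramified (v.adicCompletion K)) (AlgebraicClosure (v.adicCompletion K))) with hι
  -- (2) images of `K_v^nr`-points are fixed by `I_𝔐`
  have hfixι : ∀ (Q : ((W.localMinimalModel v).baseChange (maxUnramified (v.adicCompletion K))).toAffine.Point),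
      ∀ σ ∈ 𝔐.inertia (absoluteGaloisGroup (v.adicCompletion K)),
        WeierstrassCurve.Affine.Point.map ((absoluteGaloisGroup.toAlgEquiv _ σ : (AlgebraicClosure (v.adicCompletion K)) ≃ₐ[(v.adicCompletion K)] (AlgebraicClosure (v.adicCompletion K))) : (AlgebraicClosure (v.adicCompletion K)) →ₐ[(v.adicCompletion K)] (AlgebraicClosure (v.adicCompletion K)))
          (ι Q) = ι Q := by
    intro Q σ hσ
    rcases Q with _ | ⟨x, y, h⟩
    · rfl
    · change WeierstrassCurve.Affine.Point.map _ (WeierstrassCurve.Affine.Point.some _ _ _) = WeierstrassCurve.Affine.Point.some _ _ _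
      rw [WeierstrassCurve.Affine.Point.map_some]
      exact point_some_congr (smul_coe_maxUnramified hw h𝔐 x hσ) (smul_coe_maxUnramified hw h𝔐 y hσ)
  -- (3) `I_𝔐`-fixed points of `X(K̄_v)` come from `X(K_v^nr)`
  have hsurj : ∀ P : ((W.localMinimalModel v).baseChange (AlgebraicClosure (v.adicCompletion K))).toAffine.Point,
      (∀ σ ∈ 𝔐.inertia (absoluteGaloisGroup (v.adicCompletion K)),
        WeierstrassCurve.Affine.Point.map ((absoluteGaloisGroup.toAlgEquiv _ σ : (AlgebraicClosure (v.adicCompletion K)) ≃ₐ[(v.adicCompletion K)] (AlgebraicClosure (v.adicCompletion K))) : (AlgebraicClosure (v.adicCompletion K)) →ₐ[(v.adicCompletion K)] (AlgebraicClosure (v.adicCompletion K)))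
          P = P) → ∃ Q, ι Q = P := by
    intro P hP
    rcases P with _ | ⟨x, y, h⟩
    · exact ⟨0, map_zero ι⟩
    · have hx : x ∈ maxUnramified (v.adicCompletion K) := (mem_maxUnramified_iff_forall_inertia hw h𝔐).mpr
        fun σ hσ ↦ by
          have := hP σ hσ
          rw [WeierstrassCurve.Affine.Point.map_some, WeierstrassCurve.Affine.Point.some.injEq] at this
          exact this.1
      have hy : y ∈ maxUnramified (v.adicCompletion K) := (mem_maxUnramified_iff_forall_inertia hw h𝔐).mpr
        fun σ hσ ↦ by
          have := hP σ hσ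
          rw [WeierstrassCurve.Affine.Point.map_some, WeierstrassCurve.Affine.Point.some.injEq] at this
          exact this.2
      have hinjι : Function.Injective (IsScalarTower.toAlgHom (v.adicCompletion K) (maxUnramified (v.adicCompletion K)) (AlgebraicClosure (v.adicCompletion K))) :=
        fun a b hab ↦ Subtype.ext hab
      have h₀ : ((W.localMinimalModel v).baseChange (maxUnramified (v.adicCompletion K))).toAffine.Nonsingular ⟨x, hx⟩ ⟨y, hy⟩ :=
        (WeierstrassCurve.Affine.baseChange_nonsingular (W := W.localMinimalModel v)
          (f := IsScalarTower.toAlgHom (v.adicCompletion K) (maxUnramified (v.adicCompletion K)) (AlgebraicClosure (v.adicCompletion K))) hinjι ⟨x, hx⟩ ⟨y, hy⟩).mp h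
      exact ⟨.some _ _ h₀, rfl⟩
  -- (4) `E₀` of `J` over `𝒪ⁿʳ` maps into `E₀` of `X` over `𝒪_w`
  have hE₀ : ∀ Q : (((W.localMinimalIntegralModel v).map φ).baseChange (maxUnramified (v.adicCompletion K))).toAffine.Point,
      ((W.localMinimalIntegralModel v).map φ).HasNonsingularReduction Q →
        ReducesToNonsingular w (residue w.integer) (ι (e₁ Q)) := by
    intro Q hQ
    rcases point_cases hvR Q with rfl | ⟨x, y, h, rfl, hx⟩ | ⟨a, b, h, rfl⟩
    · rw [map_zero, map_zero]
      exact reducesToNonsingular_zero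
    · have hx' : 1 < w (x : (AlgebraicClosure (v.adicCompletion K))) := not_le.mp fun hle ↦
        (not_mem_range_iff hvR).mpr hx ⟨⟨x, (Valuation.mem_valuationSubring_iff _ _).mpr hle⟩, rfl⟩
      rw [he₁, WeierstrassCurve.Affine.Point.congrEquiv_some]
      exact reducesToNonsingular_of_one_lt hx'
    · have hns := (WeierstrassCurve.hasNonsingularReduction_some_algebraMap_iff hinjR h).mp hQ
      rw [he₁, WeierstrassCurve.Affine.Point.congrEquiv_some]
      -- transport to the `𝒪_w`-model `J ⊗ 𝒪_w` of `X ⊗ K̄ᵥ`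
      rw [← (WeierstrassCurve.Affine.Point.congrEquiv hW₀).apply_symm_apply (ι _), reducesToNonsingular_congrEquiv_iff,
        reducesToNonsingular_iff_hasNonsingularReduction]
      change (((W.localMinimalIntegralModel v).map φ).map ψ).HasNonsingularReduction
        ((WeierstrassCurve.Affine.Point.congrEquiv hW₀).symm (WeierstrassCurve.Affine.Point.some _ _ _))
      rw [WeierstrassCurve.Affine.Point.congrEquiv_symm_some]
      refine Or.inr ⟨ψ a, ψ b, hψ a, hψ b, ?_⟩
      rw [hκ, ← IsLocalRing.ResidueField.map_residue, ← IsLocalRing.ResidueField.map_residue]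
      exact (WeierstrassCurve.Affine.map_nonsingular _
        (IsLocalRing.ResidueField.map ψ).injective _ _).mpr hns
  /- the exponent `c = [J(K_v^nr) : E₀]` -/
  set H := ((W.localMinimalIntegralModel v).map φ).nonsingularReductionSubgroup hvR with hH
  refine ⟨H.index, hidx0, hidx4, fun P hP ↦ ?_⟩
  obtain ⟨P₀, rfl⟩ := hsurj P hP
  set Q₀ := e₁.symm P₀ with hQ₀
  have hP₀ : ι P₀ = ι (e₁ Q₀) := by rw [hQ₀, AddEquiv.apply_symm_apply]
  rw [hP₀, ← map_nsmul, ← map_nsmul]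
  exact hE₀ _ (AddSubgroup.nsmul_index_mem H Q₀)

end Summit.ABC.ABC.Theorems

end
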